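import Literature.ModelTheory.ExponentialFields.RealAnExp
import Literature.ModelTheory.ExponentialFields.RealExpField
import HarnessLib

/-!
# `ℝ_exp` is a reduct of `ℝ_an,exp`: o-minimality of `ℝ_exp` from van den Dries–Miller 1994

Topic `Literature/ModelTheory/ExponentialFields`.  The real exponential field
`ℝ_exp = (ℝ; 0, 1, +, −, ·, exp, ≤)` (`Language.orderedExpRing`, `Languages.lean`) is the reduct of
`ℝ_an,exp = (ℝ; <, +, ×, 0, 1, exp, {Z})` (`Language.realAnExp`, `RealAnExp.lean`) to the symbols
`+, ·, −, 0, 1, exp, ≤`.  Hence every subset of `ℝ` definable with parameters in `ℝ_exp` is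
definable with parameters in `ℝ_an,exp`, and the o-minimality of `ℝ_an,exp` — the named fact
`VandendriesMiller1994_realAnExp_isOMinimal` (L. van den Dries, C. Miller, Israel J. Math. 85
(1994); L. van den Dries, A. Macintyre, D. Marker, Ann. of Math. 140 (1994), Cor. 5.11; J. Pila,
*Point-counting and the Zilber–Pink conjecture* (2022), Thm. 8.26) — implies the o-minimality of
`ℝ_exp`, the named fact `wilkie_isOMinimal` of `RealExpField.lean` (whose docstring records this
second published source: "*van den Dries–Macintyre–Marker, Ann. of Math. 140 (1994), Cor. 5.11 for
`ℝ_{an,exp}`*"; van den Dries 1998, pp. 3–4: a reduct of an o-minimal structure is o-minimal).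

* `Language.orderedExpRing.toRealAnExp` — the inclusion of languages `L_exp →ᴸ L_an,exp`, an
  expansion on `ℝ` (`instIsExpansionOnToRealAnExp`: both interpret the common symbols by the ring
  operations, `Real.exp` and `≤`);
* `definable₁_realAnExp_of_orderedExpRing` — `ℝ_exp`-definable subsets of `ℝ` are
  `ℝ_an,exp`-definable (Mathlib's `Set.Definable.map_expansion`);
* `wilkie_isOMinimal_of_realAnExp_isOMinimal` —
  **`VandendriesMiller1994_realAnExp_isOMinimal → wilkie_isOMinimal`.**

This is a second reduction of `wilkie_isOMinimal` to an existing named fact of the tree, next to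
`wilkie_isOMinimal_of_isModelComplete` (Wilkie's model completeness, `RealExpFieldOMinimalProofs.lean`)
and `wilkie_isOMinimal_of_zeroSet_structure` (theorem of the complement,
`RealExpOMinimalOfStructure.lean`).  Nothing here is a named fact.

## References

* [VandendriesMiller1994] L. van den Dries, C. Miller, *On the real exponential field with
  restricted analytic functions*, Israel J. Math. 85 (1994), 19–56.
* [VandendriesMacintyreMarker1994] L. van den Dries, A. Macintyre, D. Marker, *The elementary
  theory of restricted analytic fields with exponentiation*, Ann. of Math. 140 (1994), Cor. 5.11.
* [Pila2022] J. Pila, *Point-counting and the Zilber–Pink conjecture*, CUP (2022), Thm. 8.26.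
* [Dries1998] L. van den Dries, *Tame topology and o-minimal structures* (1998), pp. 3–4.
-/

noncomputable section

open Set FirstOrder FirstOrder.Language

namespace Literature.ModelTheory.ExponentialFields

/-- The inclusion of the language of ordered exponential rings `(+, ·, −, 0, 1, exp; ≤)` into the
language of `ℝ_an,exp` (same symbols; no restricted analytic symbol is hit). [folklore] -/
def Language.orderedExpRing.toRealAnExp : Language.orderedExpRing →ᴸ Language.realAnExp where
  onFunction := fun {_} f =>
    match f with
    | expRingFunc.add => realAnExpFunc.add
    | expRingFunc.mul => realAnExpFunc.mul
    | expRingFunc.neg => realAnExpFunc.neg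
    | expRingFunc.zero => realAnExpFunc.zero
    | expRingFunc.one => realAnExpFunc.one
    | expRingFunc.exp => realAnExpFunc.exp
  onRelation := fun {_} R => R

/-- `ℝ_an,exp` expands `ℝ_exp` along `toRealAnExp`: the common symbols have the same
interpretation on `ℝ` (ring operations, `Real.exp`, `≤`). [folklore] -/
instance instIsExpansionOnToRealAnExp : Language.orderedExpRing.toRealAnExp.IsExpansionOn ℝ where
  map_onFunction := by
    intro n f v
    cases f <;> rfl
  map_onRelation := by
    intro n R v
    cases R
    rfl

/-- **`ℝ_exp`-definable subsets of `ℝ` are `ℝ_an,exp`-definable** (`ℝ_exp` is a reduct of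
`ℝ_an,exp`). [folklore] -/
theorem definable₁_realAnExp_of_orderedExpRing {S : Set ℝ}
    (hS : (univ : Set ℝ).Definable₁ Language.orderedExpRing S) :
    (univ : Set ℝ).Definable₁ Language.realAnExp S :=
  Set.Definable.map_expansion (L := Language.orderedExpRing) hS Language.orderedExpRing.toRealAnExp

/-- **O-minimality of `ℝ_exp` from the o-minimality of `ℝ_an,exp`** (van den Dries–Miller 1994;
van den Dries–Macintyre–Marker 1994, Cor. 5.11; Pila 2022, Thm. 8.26): a reduct of an o-minimal
structure is o-minimal, and `ℝ_exp` is a reduct of `ℝ_an,exp`; so the named fact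
`VandendriesMiller1994_realAnExp_isOMinimal` implies the named fact `wilkie_isOMinimal`.
[cite: Pila2022, Thm. 8.26] [cite: VandendriesMacintyreMarker1994, Cor. 5.11] -/
theorem wilkie_isOMinimal_of_realAnExp_isOMinimal
    (h : VandendriesMiller1994_realAnExp_isOMinimal) : wilkie_isOMinimal :=
  fun S hS => h S (definable₁_realAnExp_of_orderedExpRing hS)

end Literature.ModelTheory.ExponentialFields
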